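import Summits.BirchSwinnertonDyer.BirchSwinnertonDyer.Theorems.ClassRecordThreeEulerHalvesAtThreeCartanCorrespondenceCubicSum
import Mathlib.FieldTheory.Finite.Basic
import HarnessLib

/-!
# The cubic class-count law (U♯ at the principal-series places): exact structure and regime decomposition

Helper file riding `--supports stmt-BirchSwinnertonDyer-19109` (crux `EulerHalvesAtThree`; UNREGISTERED sub-line
`Cruxes/EulerHalvesAtThree/Lines/cartan_corr`, seat `bsd-idea-10` g12). It sharpens the input `CubicClassCountLawAtThree` of
`Theorems/ClassRecordThreeEulerHalvesAtThreeCartanCorrespondenceCubicSum.lean` (U♯ ⟸ closed form ∧ COUNT LAW ∧ cuspidal places; U♯ feeds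
NUM and hence the `cartan` v9 stub (F2b♭) `CartanDegree.CartanHomLatticeDictionaryAtThreeVal`). HONEST FRAMING: the count law stays OPEN
(exactly in the residual class `R` below); no crux, no route item, no registered stub is proved here; BSD is proved for no curve.
The companion file `…CubicSumRungs.lean` decides the law for every prime `q ≡ 1 (3)` up to `157`.

## The exact structure (paper; every identity script-verified for all primes `q ≡ 1 (3)`, `q ≤ 157` — card `Lines/cartan_corr.md` r1.4)
`Σ_Q = Σ_{x∈𝔽_q^×} θ(Q(x)/x) = A + Bω + Cω²` (`A,B,C` = `cubicClassCount`), `Q = x²+βx+γ`, `D = β²−4γ`, `e = (q−1)/3`, `ε` = Legendre.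
Counting solutions of `x + β + γ/x = t`: **`Σ_Q = Σ_t θ(t)ε(g(t))`, `g(t) = t² − 2βt + D`.**
1. **AXIS LAW** (elementary; the involution `t ↦ D/t`, `g(D/t) = (D/t²)g(t)`): `conj(Σ_Q) = ε(D)θ̄(D)Σ_Q`. Count form
   (`CubicAxisCountAtThree`): for irreducible `Q` with `D^e = ζ^m`, `#{x ≠ 0 : D·Q(x)/x a cube} = (q−1)/3` (pair `t ↔ D/t` on the coset
   `{Dt a cube}`: the root counts `1+ε(g(t))` and `1−ε(g(t))` add up to `2`). Hence `|Σ_Q|² = 3n_Q²` (`sumNormAxis_of_axisCount`, PROVED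
   from the count form), and the count law reads `3 ∤ n_Q`, i.e. `¬(A ≡ B ≡ C (3))`. Split `Q`: `Σ_Q ∈ μ₆ℤ`, `3 ∤ |Σ_Q|`.
2. **DETERMINANT** (elementary): `P_Q := Σ_{a,b} θ(b)ε(Res(T²+aT+b, g)) = ε(D)θ(D)q`, so the Frobenius pair has `λ₁+λ₂ = −Σ_Q`,
   `λ₁λ₂ = ε(D)θ(D)q`, `|λᵢ| = √q` (the `(ε,θ)`-part of `H¹` of `w² = u⁶ − 2βu³ + D`, Jacobian ∼ `E_Q²`); `|Σ_Q|² ≤ 4q`.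
3. **`β = 0` MASTER FORMULA** (`π := J(θ,θ) ≡ −1 (3)` primary, `J(θ̄,ε) = θ̄(4)π̄`, `J(θ̄ε,ε)J(θ̄,ε) = ε(−1)q`):
   `Σ_s θ(s)ε(s²−c) = θ̄(c)θ(4)π + ε(−c)θ̄(4c)π̄`; so for irreducible `x²+γ`: `|Σ|² = |π − θ(4)π̄|²`, prime to `9` **iff `2` is not a
   cube mod `q`** (`q ≠ A²+27B²`; Gauss's cyclotomic numbers of order 3, D.A. art. 358); when `2` is a cube, `ord₃ = 3` exactly there
   (`q = 31, 43, 109, 127, 157`). Nodes N1♯ `CubicBetaZeroCountLawAtThree`, N1′ `CubicBetaZeroCubeCaseAtThree`.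
4. **SECOND MOMENT** (orthogonality + `|π|² = q`): `Σ_{Q irr}|Σ_Q|² = q(q−1)²/2`; with the scaling classes (`q−1` forms per `j = β²/γ ≠ 0`,
   `(q−1)/2` for `β = 0`) and 1, 3: all irreducible `Q` failing the law forces `27 ∣ q(q−1)`. **So the law holds whenever `2` is a non-cube
   or `q ≢ 1 (27)`** (node N2 `CubicClassCountLawSieveAtThree`, paper-proved), leaving the RESIDUAL CLASS `R = {q ≡ 1 (27), 2 a cube}
   = {109, 433, 811, …}` (node N3 `CubicClassCountLawResidualAtThree`, OPEN; witnesses `(β,γ) = (1,3),(1,2),(1,5)` by search, `q = 109`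
   kernel-decided in the Rungs file; heuristic: mod-3 monodromy of `E_Q` in the family).
PROVED here: `3 ∣ |Σ_Q|²` for every irreducible `Q` (the cubic classes partition `𝔽_q^×`), axis-count ⇒ `3·□`, and the assembly
`cubicClassCountLaw_of_regimes : N1♯ → N2 → N3 → CubicClassCountLawAtThree` (+ `cubicTorusPairSum_of_regimes`). Prior art: the
`ε(D)`-dichotomy and Legendre ∕ Soto-Andrade evaluations of such double-coset sums [cite: Chen2000, §§8–9]; cubic Jacobi sums
[cite: Terras1999, Ch. 8]; nothing located computes `ord₃` of these sums.
-/

set_option linter.dupNamespace false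
set_option autoImplicit false

namespace Summit.BirchSwinnertonDyer.BirchSwinnertonDyer.Theorems.CartanCorrespondence

open Summit.BirchSwinnertonDyer.BirchSwinnertonDyer.Theorems.CartanDegree
open Summit.BirchSwinnertonDyer.BirchSwinnertonDyer.Theorems.CartanTorusCubeCut

/-! ## §1 PROVED: the elementary algebra of the hexagonal norm (the `3 ∣ |Σ|²` half of the law and the axis ⇒ `3·□` step) -/

/-- PROVED: `A²+B²+C²−AB−BC−CA = (A+B+C)² − 3(AB+BC+CA)`. [folklore] -/
theorem hexNorm_eq_sq_sub (A B C : ℤ) : hexNorm A B C = (A + B + C) ^ 2 - 3 * (A * B + B * C + C * A) := by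
  unfold hexNorm; ring

/-- PROVED: `3 ∣ A+B+C → 3 ∣ hexNorm A B C` — for an irreducible form the three class counts add up to `q − 1 ≡ 0 (3)`, so `3 ∣ |Σ_Q|²` always;
the count law asks for `9 ∤`. [folklore] -/
theorem three_dvd_hexNorm {A B C : ℤ} (h : 3 ∣ A + B + C) : 3 ∣ hexNorm A B C := by
  rw [hexNorm_eq_sq_sub]
  exact dvd_sub (dvd_pow h two_ne_zero) (dvd_mul_right 3 _)

/-- PROVED: the axis ⇒ `3·□` step — if one class count equals `e` and the three add up to `3e` (so the third is `2e − B`), then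
`|Σ|² = 3(e − B)²`. [folklore] -/
theorem hexNorm_axis (e B : ℤ) : hexNorm e B (2 * e - B) = 3 * (e - B) ^ 2 := by
  unfold hexNorm; ring

/-- PROVED: `hexNorm` is invariant under the cyclic permutation of its arguments (so `hexNorm_axis` covers all three positions). [folklore] -/
theorem hexNorm_cycle (A B C : ℤ) : hexNorm A B C = hexNorm B C A := by
  unfold hexNorm; ring


/-! ## §1b PROVED: the three cubic classes partition `𝔽_q^×` (so `A+B+C = q−1` and `3 ∣ |Σ_Q|²` for irreducible `Q`) -/

/-- PROVED: `1 + ζ + ζ² = 0` for a primitive cube root of unity in a domain. [folklore] -/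
theorem one_add_add_sq_eq_zero {R : Type*} [CommRing R] [IsDomain R] {ζ : R} (hζ3 : ζ ^ 3 = 1) (hζ1 : ζ ≠ 1) :
    1 + ζ + ζ ^ 2 = 0 := by
  have h : (ζ - 1) * (1 + ζ + ζ ^ 2) = 0 := by linear_combination hζ3
  exact (mul_eq_zero.mp h).resolve_left (sub_ne_zero.mpr hζ1)

/-- PROVED: in a domain, a cube root of unity is `1`, `ζ` or `ζ²` (`ζ` a primitive one). [folklore] -/
theorem eq_pow_of_pow_three_eq_one {R : Type*} [CommRing R] [IsDomain R] {ζ w : R} (hζ3 : ζ ^ 3 = 1) (hζ1 : ζ ≠ 1)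
    (hw : w ^ 3 = 1) : w = ζ ^ 0 ∨ w = ζ ^ 1 ∨ w = ζ ^ 2 := by
  have hs := one_add_add_sq_eq_zero hζ3 hζ1
  have h : (w - 1) * ((w - ζ) * (w - ζ ^ 2)) = 0 := by
    linear_combination hw + (w - w ^ 2) * hs + (w - 1) * hζ3
  rcases mul_eq_zero.mp h with h0 | h12
  · exact Or.inl (by rw [pow_zero]; exact sub_eq_zero.mp h0)
  · rcases mul_eq_zero.mp h12 with h1 | h2
    · exact Or.inr (Or.inl (by rw [pow_one]; exact sub_eq_zero.mp h1))
    · exact Or.inr (Or.inr (sub_eq_zero.mp h2))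

/-- PROVED: `3 · (q−1)/3 = q − 1` for `q ≡ 1 (3)`. [folklore] -/
theorem three_mul_third {q : ℕ} (h1 : q % 3 = 1) : 3 * ((q - 1) / 3) = q - 1 := by
  have h : 3 ∣ q - 1 := by omega
  exact Nat.mul_div_cancel' h

/-- PROVED (trichotomy): for `x, y ∈ 𝔽_q^×` (`q ≡ 1 (3)` prime, `ζ` a primitive cube root), `y^e = ζ^k x^e` for some `k ∈ {0,1,2}`,
`e = (q−1)/3` — the class of `y` relative to `x`. [folklore] -/
theorem cubeClass_trichotomy {q : ℕ} [hq : Fact q.Prime] (h1 : q % 3 = 1) {ζ : ZMod q} (hζ3 : ζ ^ 3 = 1) (hζ1 : ζ ≠ 1)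
    {x y : ZMod q} (hx : x ≠ 0) (hy : y ≠ 0) :
    y ^ ((q - 1) / 3) = ζ ^ 0 * x ^ ((q - 1) / 3) ∨ y ^ ((q - 1) / 3) = ζ ^ 1 * x ^ ((q - 1) / 3) ∨
      y ^ ((q - 1) / 3) = ζ ^ 2 * x ^ ((q - 1) / 3) := by
  have hyx : y * x⁻¹ ≠ 0 := mul_ne_zero hy (inv_ne_zero hx)
  have hw3 : ((y * x⁻¹) ^ ((q - 1) / 3)) ^ 3 = 1 := by
    rw [← pow_mul, Nat.mul_comm ((q - 1) / 3) 3, three_mul_third h1]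
    exact ZMod.pow_card_sub_one_eq_one hyx
  have hye : y ^ ((q - 1) / 3) = (y * x⁻¹) ^ ((q - 1) / 3) * x ^ ((q - 1) / 3) := by
    rw [← mul_pow, mul_assoc, inv_mul_cancel₀ hx, mul_one]
  rcases eq_pow_of_pow_three_eq_one hζ3 hζ1 hw3 with h | h | h
  · exact Or.inl (by rw [hye, h])
  · exact Or.inr (Or.inl (by rw [hye, h]))
  · exact Or.inr (Or.inr (by rw [hye, h]))

/-- PROVED: the powers `ζ^0, ζ^1, ζ^2` of a primitive cube root of unity are pairwise distinct (exponents `< 3`). [folklore] -/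
theorem pow_injective_of_primitiveCubeRoot {R : Type*} [CommRing R] [IsDomain R] {ζ : R} (hζ3 : ζ ^ 3 = 1) (hζ1 : ζ ≠ 1)
    {j k : ℕ} (hj : j < 3) (hk : k < 3) (h : ζ ^ j = ζ ^ k) : j = k := by
  have hζ0 : ζ ≠ 0 := by rintro rfl; norm_num at hζ3
  have h2 : ζ ^ 2 ≠ 1 := by
    intro h2; apply hζ1
    calc ζ = ζ * ζ ^ 2 := by rw [h2, mul_one]
      _ = ζ ^ 3 := by ring
      _ = 1 := hζ3
  have h01 : ζ ^ 0 ≠ ζ ^ 1 := by rw [pow_zero, pow_one]; exact fun h' => hζ1 h'.symm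
  have h02 : ζ ^ 0 ≠ ζ ^ 2 := by rw [pow_zero]; exact fun h' => h2 h'.symm
  have h12 : ζ ^ 1 ≠ ζ ^ 2 := by
    rw [pow_one]; intro h'
    have hz : ζ * (ζ - 1) = 0 := by linear_combination -h'
    rcases mul_eq_zero.mp hz with h0 | h1
    · exact hζ0 h0
    · exact hζ1 (sub_eq_zero.mp h1)
  interval_cases j <;> interval_cases k <;>
    first
      | rfl
      | exact absurd h h01
      | exact absurd h h02
      | exact absurd h h12
      | exact absurd h.symm h01
      | exact absurd h.symm h02
      | exact absurd h.symm h12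

/-- PROVED: **the three cubic classes partition `𝔽_q^×`** — for an irreducible form the three class counts add up to `q − 1`. [folklore] -/
theorem cubicClassCount_sum {q : ℕ} [hq : Fact q.Prime] (h1 : q % 3 = 1) {ζ : ZMod q} (hζ3 : ζ ^ 3 = 1) (hζ1 : ζ ≠ 1)
    (b c : ZMod q) (hirr : ∀ x : ZMod q, x ^ 2 + b * x + c ≠ 0) :
    cubicClassCount q ζ 1 b c 0 + cubicClassCount q ζ 1 b c 1 + cubicClassCount q ζ 1 b c 2 = q - 1 := by
  classical
  set S : ℕ → Finset (ZMod q) := fun k =>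
    Finset.univ.filter (fun x : ZMod q => x ≠ 0 ∧ (1 * x ^ 2 + b * x + c) ^ ((q - 1) / 3) = ζ ^ k * x ^ ((q - 1) / 3)) with hS
  have hSk : ∀ k, cubicClassCount q ζ 1 b c k = (S k).card := fun k => rfl
  have hdisj : ∀ j k, j < 3 → k < 3 → j ≠ k → Disjoint (S j) (S k) := by
    intro j k hj hk hjk
    rw [hS, Finset.disjoint_filter]
    rintro x - ⟨hx, hxj⟩ ⟨-, hxk⟩
    apply hjk
    apply pow_injective_of_primitiveCubeRoot hζ3 hζ1 hj hk
    have hxe : x ^ ((q - 1) / 3) ≠ 0 := pow_ne_zero _ hx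
    exact mul_right_cancel₀ hxe (hxj.symm.trans hxk)
  have hunion : S 0 ∪ S 1 ∪ S 2 = Finset.univ.filter (fun x : ZMod q => x ≠ 0) := by
    ext x
    simp only [hS, Finset.mem_union, Finset.mem_filter, Finset.mem_univ, true_and]
    constructor
    · rintro ((⟨hx, -⟩ | ⟨hx, -⟩) | ⟨hx, -⟩) <;> exact hx
    · intro hx
      have hy : (1 * x ^ 2 + b * x + c) ≠ 0 := by rw [one_mul]; exact hirr x
      rcases cubeClass_trichotomy h1 hζ3 hζ1 hx hy with h | h | h
      · exact Or.inl (Or.inl ⟨hx, h⟩)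
      · exact Or.inl (Or.inr ⟨hx, h⟩)
      · exact Or.inr ⟨hx, h⟩
  have hcard : (Finset.univ.filter (fun x : ZMod q => x ≠ 0)).card = q - 1 := by
    rw [Finset.filter_ne' Finset.univ (0 : ZMod q), Finset.card_erase_of_mem (Finset.mem_univ _), Finset.card_univ, ZMod.card]
  have hd01 := hdisj 0 1 (by norm_num) (by norm_num) (by norm_num)
  have hd02 := hdisj 0 2 (by norm_num) (by norm_num) (by norm_num)
  have hd12 := hdisj 1 2 (by norm_num) (by norm_num) (by norm_num)
  rw [hSk 0, hSk 1, hSk 2, ← hcard, ← hunion, Finset.card_union_of_disjoint (Finset.disjoint_union_left.mpr ⟨hd02, hd12⟩),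
    Finset.card_union_of_disjoint hd01]

/-- **`3 ∣ |Σ_Q|²` FOR EVERY IRREDUCIBLE FORM** — the easy half of the count law (the law asks for `9 ∤`); PROVED below (`cubicSumNormThreeDvd`)
from the partition `A + B + C = q − 1` and `hexNorm ≡ (A+B+C)² (mod 3)`. [folklore] -/
@[conjecture]
def CubicSumNormThreeDvdAtThree : Prop :=
    ∀ (q : ℕ) [Fact q.Prime], q % 3 = 1 → ∀ ζ : ZMod q, ζ ^ 3 = 1 → ζ ≠ 1 →
      ∀ b c : ZMod q, (∀ x : ZMod q, x ^ 2 + b * x + c ≠ 0) → (3 : ℤ) ∣ cubicSumNorm q ζ 1 b c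

/-- PROVED — `3 ∣ |Σ_Q|²` for every irreducible form (`CubicSumNormThreeDvdAtThree` BY NAME). [folklore] -/
theorem cubicSumNormThreeDvd : CubicSumNormThreeDvdAtThree := by
  intro q hF h1 ζ hζ3 hζ1 b c hirr
  unfold cubicSumNorm
  apply three_dvd_hexNorm
  have hs := cubicClassCount_sum h1 hζ3 hζ1 b c hirr
  have h3 : (3 : ℤ) ∣ ((q - 1 : ℕ) : ℤ) := by
    have : 3 ∣ q - 1 := by omega
    exact_mod_cast this
  have hcast : ((cubicClassCount q ζ 1 b c 0 : ℕ) : ℤ) + (cubicClassCount q ζ 1 b c 1 : ℕ) + (cubicClassCount q ζ 1 b c 2 : ℕ) =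
      ((q - 1 : ℕ) : ℤ) := by exact_mod_cast hs
  rw [hcast]; exact h3

/-- **THE `3·□` LAW** (`|Σ_Q|² = 3n²` for irreducible `Q`; the CubicSum file's «`n̄ ∈ 3·□`» observation): PROVED below from the axis law
in count form (`sumNormAxis_of_axisCount`). [folklore] -/
@[conjecture]
def CubicSumNormAxisAtThree : Prop :=
    ∀ (q : ℕ) [Fact q.Prime], q % 3 = 1 → ∀ ζ : ZMod q, ζ ^ 3 = 1 → ζ ≠ 1 →
      ∀ b c : ZMod q, ¬ IsSquare (b ^ 2 - 4 * c) → ∃ n : ℤ, cubicSumNorm q ζ 1 b c = 3 * n ^ 2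

/-! ## §3 The exact structure as statements, the regime decomposition, and its PROVED assembly -/

/-- **THE AXIS LAW IN COUNT FORM** (paper-PROVED by the involution `t ↦ D/t`, module docstring item 1; Lean proof open, M-size): for `q ≡ 1 (3)`,
a primitive cube root `ζ`, and `x² + bx + c` with NON-SQUARE discriminant `D = b² − 4c` in cubic class `m` (`D^e = ζ^m`, `e = (q−1)/3`), the number
of `x ∈ 𝔽_q^×` with `Q(x)/x` in class `−m`, i.e. with `D·Q(x)/x` a cube, is exactly `(q−1)/3`. Equivalent to `conj(Σ_Q) = −θ̄(D)Σ_Q`, whence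
`|Σ_Q|² = 3n_Q²` (`hexNorm_axis`). Verified for both `ζ` and sampled forms at every `q ≤ 157`. Why it might fail: only through an indexing slip
(class `2m % 3`). [folklore] -/
@[conjecture]
def CubicAxisCountAtThree : Prop :=
    ∀ (q : ℕ) [Fact q.Prime], q % 3 = 1 → ∀ ζ : ZMod q, ζ ^ 3 = 1 → ζ ≠ 1 →
      ∀ (b c : ZMod q) (m : ℕ), ¬ IsSquare (b ^ 2 - 4 * c) → (b ^ 2 - 4 * c) ^ ((q - 1) / 3) = ζ ^ m →
        cubicClassCount q ζ 1 b c (2 * m % 3) = (q - 1) / 3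

/-- PROVED — **AXIS LAW ⇒ `3·□` LAW**: `CubicSumNormAxisAtThree` BY NAME from `CubicAxisCountAtThree` (the class-`(−m)` count is `e`, the three
counts add up to `3e`, and `hexNorm e B (2e−B) = 3(e−B)²`). [folklore] -/
theorem sumNormAxis_of_axisCount (hA : CubicAxisCountAtThree) : CubicSumNormAxisAtThree := by
  intro q hF h1 ζ hζ3 hζ1 b c hD
  have hirr : ∀ x : ZMod q, x ^ 2 + b * x + c ≠ 0 := by
    intro x hx; apply hD
    exact ⟨2 * x + b, by linear_combination (-4 : ZMod q) * hx⟩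
  have hD0 : b ^ 2 - 4 * c ≠ 0 := fun h => hD ⟨0, by rw [h, mul_zero]⟩
  obtain ⟨m, hm, hDm⟩ : ∃ m : ℕ, m < 3 ∧ (b ^ 2 - 4 * c) ^ ((q - 1) / 3) = ζ ^ m := by
    rcases cubeClass_trichotomy h1 hζ3 hζ1 one_ne_zero hD0 with h | h | h
    · exact ⟨0, by norm_num, by rw [h, one_pow, mul_one]⟩
    · exact ⟨1, by norm_num, by rw [h, one_pow, mul_one]⟩
    · exact ⟨2, by norm_num, by rw [h, one_pow, mul_one]⟩
  have hcnt := hA q h1 ζ hζ3 hζ1 b c m hD hDm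
  have hsum := cubicClassCount_sum h1 hζ3 hζ1 b c hirr
  have h3e := three_mul_third h1
  set e := (q - 1) / 3 with he
  set A := cubicClassCount q ζ 1 b c 0 with hA0
  set B := cubicClassCount q ζ 1 b c 1 with hB0
  set C := cubicClassCount q ζ 1 b c 2 with hC0
  have hsum' : (A : ℤ) + B + C = 3 * e := by rw [← h3e] at hsum; exact_mod_cast hsum
  unfold cubicSumNorm
  rw [← hA0, ← hB0, ← hC0]
  interval_cases m
  · -- class `0`: `A = e`
    have hk : 2 * 0 % 3 = 0 := rfl
    rw [hk, ← hA0] at hcnt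
    have hAe : (A : ℤ) = e := by exact_mod_cast hcnt
    have hC : (C : ℤ) = 2 * e - B := by omega
    refine ⟨(e : ℤ) - B, ?_⟩
    rw [hAe, hC]; exact hexNorm_axis _ _
  · -- class `2`: `C = e`
    have hk : 2 * 1 % 3 = 2 := rfl
    rw [hk, ← hC0] at hcnt
    have hCe : (C : ℤ) = e := by exact_mod_cast hcnt
    have hB : (B : ℤ) = 2 * e - A := by omega
    refine ⟨(e : ℤ) - A, ?_⟩
    rw [hexNorm_cycle, hexNorm_cycle, hCe, hB]; exact hexNorm_axis _ _
  · -- class `1`: `B = e`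
    have hk : 2 * 2 % 3 = 1 := rfl
    rw [hk, ← hB0] at hcnt
    have hBe : (B : ℤ) = e := by exact_mod_cast hcnt
    have hA' : (A : ℤ) = 2 * e - C := by omega
    refine ⟨(e : ℤ) - C, ?_⟩
    rw [hexNorm_cycle, hBe, hA']; exact hexNorm_axis _ _

/-- **N1♯ — THE `β = 0` FAMILY** (paper-PROVED: Gauss's cyclotomic numbers of order 3 ∕ the master formula, docstring item 3): if `2` is NOT a cube
mod `q` then EVERY irreducible `x² + γ` is a count-law witness: `ord₃|Σ_{x²+γ}|² = ord₃|π − θ(4)π̄|² = 1`. Verified for all `γ`, both `ζ`, every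
`q ≤ 157`. Why it might fail: a slip in `J(θ̄,ε) = θ̄(4)π̄`; refutable by one `decide`. [folklore] -/
@[conjecture]
def CubicBetaZeroCountLawAtThree : Prop :=
    ∀ (q : ℕ) [Fact q.Prime], q % 3 = 1 → (2 : ZMod q) ^ ((q - 1) / 3) ≠ 1 → ∀ ζ : ZMod q, ζ ^ 3 = 1 → ζ ≠ 1 →
      ∀ γ : ZMod q, γ ≠ 0 → ¬ IsSquare (-γ) → padicValInt 3 (cubicSumNorm q ζ 1 0 γ) = 1

/-- **N1′ — THE `β = 0` FAMILY FAILS EXACTLY WHEN `2` IS A CUBE** (paper-PROVED, same formula: `|Σ|² = |π − π̄|² = 3b²`, `3 ∣ b ≠ 0`): then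
`ord₃|Σ_{x²+γ}|² ≥ 3` for every irreducible `x² + γ` (`q = 31, 43, 109, 127, 157`: value `3`). The sanity companion of N1♯; refutable by one
`decide`. [folklore] -/
@[conjecture]
def CubicBetaZeroCubeCaseAtThree : Prop :=
    ∀ (q : ℕ) [Fact q.Prime], q % 3 = 1 → (2 : ZMod q) ^ ((q - 1) / 3) = 1 → ∀ ζ : ZMod q, ζ ^ 3 = 1 → ζ ≠ 1 →
      ∀ γ : ZMod q, γ ≠ 0 → ¬ IsSquare (-γ) → 3 ≤ padicValInt 3 (cubicSumNorm q ζ 1 0 γ)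

/-- **N2 — THE SIEVE REGIME** (paper-PROVED from the axis law, the second moment `Σ_{Q irr}|Σ_Q|² = q(q−1)²/2`, the scaling classes and N1♯ ∕ N1′,
docstring item 4): the count law for every prime `q ≡ 1 (3)` with `q ≢ 1 (27)`. Why it might fail: an arithmetic slip in the mod-`27` bookkeeping
(`27 ∣ q(q−1)` forced); refutable by search at one prime. [folklore] -/
@[conjecture]
def CubicClassCountLawSieveAtThree : Prop :=
    ∀ (q : ℕ) [Fact q.Prime], q % 3 = 1 → q % 27 ≠ 1 →
      ∃ ζ b c : ZMod q, ζ ^ 3 = 1 ∧ ζ ≠ 1 ∧ (∀ x : ZMod q, x ^ 2 + b * x + c ≠ 0) ∧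
        padicValInt 3 (cubicSumNorm q ζ 1 b c) = 1

/-- **N3 — THE RESIDUAL CLASS `R`** (GENUINELY OPEN here): the count law for the primes `q ≡ 1 (27)` at which `2` is a cube (`q = A² + 27B²`):
`109, 433, 811, …`; witnesses `(β,γ) = (1,3), (1,2), (1,5)` by search, `q = 109` kernel-decided in `…CubicSumRungs.lean`. Why it might fail: a prime of `R` at which every
irreducible form has `A ≡ B ≡ C (3)` (none known; heuristically impossible by mod-3 equidistribution of `E_Q`). [folklore] -/
@[conjecture]
def CubicClassCountLawResidualAtThree : Prop :=
    ∀ (q : ℕ) [Fact q.Prime], q % 3 = 1 → q % 27 = 1 → (2 : ZMod q) ^ ((q - 1) / 3) = 1 →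
      ∃ ζ b c : ZMod q, ζ ^ 3 = 1 ∧ ζ ≠ 1 ∧ (∀ x : ZMod q, x ^ 2 + b * x + c ≠ 0) ∧
        padicValInt 3 (cubicSumNorm q ζ 1 b c) = 1

/-- PROVED: for a prime `q ≡ 1 (3)` there is a primitive cube root of unity in `𝔽_q` (Cauchy's theorem in `(ZMod q)ˣ`, of order `q − 1`). [folklore] -/
theorem exists_primitiveCubeRoot (q : ℕ) [hq : Fact q.Prime] (h1 : q % 3 = 1) : ∃ ζ : ZMod q, ζ ^ 3 = 1 ∧ ζ ≠ 1 := by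
  have hcard : 3 ∣ Fintype.card (ZMod q)ˣ := by
    rw [ZMod.card_units_eq_totient, Nat.totient_prime hq.out]
    have := hq.out.two_le; omega
  haveI : Fact (Nat.Prime 3) := ⟨Nat.prime_three⟩
  obtain ⟨g, hg⟩ := exists_prime_orderOf_dvd_card 3 hcard
  refine ⟨(g : ZMod q), ?_, ?_⟩
  · rw [← Units.val_pow_eq_pow_val, ← hg, pow_orderOf_eq_one, Units.val_one]
  · intro h
    have hg1 : g = 1 := Units.val_eq_one.mp h
    rw [hg1, orderOf_one] at hg
    exact absurd hg (by norm_num)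

/-- PROVED: for an odd prime `q` some `γ ≠ 0` has `−γ` a non-square, i.e. `x² + γ` is irreducible. [folklore] -/
theorem exists_neg_nonsquare (q : ℕ) [hq : Fact q.Prime] (h2 : q ≠ 2) : ∃ γ : ZMod q, γ ≠ 0 ∧ ¬ IsSquare (-γ) := by
  have hch : ringChar (ZMod q) ≠ 2 := by rw [ZMod.ringChar_zmod_n]; exact h2
  obtain ⟨a, ha⟩ := FiniteField.exists_nonsquare hch
  refine ⟨-a, ?_, by rwa [neg_neg]⟩
  intro h0
  apply ha
  rw [neg_eq_zero] at h0
  exact ⟨0, by rw [h0, mul_zero]⟩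

/-- PROVED: `x² + γ` has no root when `−γ` is a non-square. [folklore] -/
theorem irreducible_of_neg_nonsquare {q : ℕ} {γ : ZMod q} (h : ¬ IsSquare (-γ)) : ∀ x : ZMod q, x ^ 2 + 0 * x + γ ≠ 0 := by
  intro x hx
  apply h
  exact ⟨x, by linear_combination -hx⟩

/-- PROVED — **THE REGIME DECOMPOSITION OF THE COUNT LAW**: `CubicClassCountLawAtThree` BY NAME from N1♯ (the `β = 0` family when `2` is not a
cube; paper-proved), N2 (the sieve regime `q ≢ 1 (27)`; paper-proved) and N3 (the residual class `R`; OPEN). [folklore] -/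
theorem cubicClassCountLaw_of_regimes (hN1 : CubicBetaZeroCountLawAtThree) (hN2 : CubicClassCountLawSieveAtThree)
    (hN3 : CubicClassCountLawResidualAtThree) : CubicClassCountLawAtThree := by
  intro q hF h1
  by_cases h27 : q % 27 = 1
  · by_cases h2 : (2 : ZMod q) ^ ((q - 1) / 3) = 1
    · exact hN3 q h1 h27 h2
    · have hq2 : q ≠ 2 := by rintro rfl; norm_num at h1
      obtain ⟨ζ, hζ3, hζ1⟩ := exists_primitiveCubeRoot q h1
      obtain ⟨γ, hγ0, hγ⟩ := exists_neg_nonsquare q hq2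
      exact ⟨ζ, 0, γ, hζ3, hζ1, irreducible_of_neg_nonsquare hγ, hN1 q h1 h2 ζ hζ3 hζ1 γ hγ0 hγ⟩
  · exact hN2 q h1 h27

/-- PROVED — conversely the count law gives each regime statement of the `∃`-shape back (N2 and N3 are literally restrictions). [folklore] -/
theorem sieve_of_cubicClassCountLaw (h : CubicClassCountLawAtThree) : CubicClassCountLawSieveAtThree :=
  fun q _ h1 _ => h q h1

/-- PROVED — … and the residual class statement. [folklore] -/
theorem residual_of_cubicClassCountLaw (h : CubicClassCountLawAtThree) : CubicClassCountLawResidualAtThree :=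
  fun q _ h1 _ _ => h q h1

/-- PROVED — U♯ (`CubicTorusPairSumAtThree`) BY NAME from the closed form, the three regime statements and the cuspidal places. [folklore] -/
theorem cubicTorusPairSum_of_regimes (hI : CubicTorusPairSumClosedFormAtThree) (hN1 : CubicBetaZeroCountLawAtThree)
    (hN2 : CubicClassCountLawSieveAtThree) (hN3 : CubicClassCountLawResidualAtThree) (hC : CubicTorusPairSumAtThreeCuspidalPlaces) :
    CubicTorusPairSumAtThree :=
  cubicTorusPairSum_of_closedForm hI (cubicClassCountLaw_of_regimes hN1 hN2 hN3) hC

end Summit.BirchSwinnertonDyer.BirchSwinnertonDyer.Theorems.CartanCorrespondence
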